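import Literature.NumberTheory.GelbartRogawski1991.FiniteAdelicSplittingAssembly
import Literature.NumberTheory.Weil1964.AdelicMetaplecticFinRep
import HarnessLib

-- buildfix G11b-3 recipe (LEDGER B13-1/B13-3): elaborate sequentially so the trailing `attribute [implicit_reducible]`
-- block (reducibilityCoreExt is keyed to the async environment branch) is in force at `.olean` export.
set_option Elab.async false

/-!
# The finite Weil representation of the place-assembled splitting IS `Ω = ⊗'_v ω_v`

[Weil1964, Chap. III n° 37–38 pp. 188–190]: the adelic metaplectic representation is the restricted tensor product
`𝐫_𝐀 = ⊗_v 𝐫_v` of the local ones; [GelbartRogawski1991, §3.1 Prop. 3.1.1 p. 455 L1–3]: the splitting over `G(𝐀_f)`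
is the product of local splittings `s_v`.  The tree's `FinLocalSplittings.finSplitting`
(`FiniteAdelicSplittingAssembly` §4) is the finite-adelic section `g ↦ (ι_𝔸(1, g), 1 ⊗ Ω(g))` of
`Mp_ψ(𝕎_𝔸)ᶜᵒⁿᵗ → Sp(𝕎_𝔸)` over `U(J)(𝔸_{F,f})`, assembled from a family `𝓢` of local splittings, with
`Ω = 𝓢.Omega = (⊗'_v ω_v) ∘ finAdelicEquiv`.  This file reads it in the currency of `Weil1964.finRepMp` (the finite
factor `ω_f` of `ω ∘ s` for a section `s` whose symplectic components fix the archimedean vectors,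
`AdelicMetaplecticFinRep`) — the currency in which the dual-pair files (`UnitaryDualPairWeilCoinvariants`,
`…Reference`) speak:

* `FinLocalSplittings.harch_finSplitting` — the symplectic components `ι_𝔸(1, g)` fix the archimedean vectors;
* **`FinLocalSplittings.finRepMp_finSplitting_apply` / `finRepMp_finSplitting`** — `ω_f^{s_f} = Ω`: the finite Weil
  representation of the place-assembled section IS the restricted tensor product `Ω` of the local Weil
  representations (uniqueness of the finite factor, `finRepMp_unique`, against `omega_finSplitting_tmul`);
* `FinLocalSplittings.finRepMp_finSplitting_piProdSB` — its action on pure tensors, factor by factor.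

So `𝓢.finSplitting` is a finite-adelic section over `ι_𝔸 ∘ (1, ·)`, continuous (`continuous_finSplitting`), whose
`finRepMp` is the restricted tensor product `𝓢.OmegaPi` (`isRestrictedTensorProductRep_finiteAdeleRep`) read through
`finAdelicEquiv` — a reference section in the sense of `UnitaryDualPairWeilCoinvariantsReference` for the
single-group datum.  Theorems only; no definition, no named fact, no `sorry`.

## References
* [Weil1964] A. Weil, *Sur certains groupes d'opérateurs unitaires*, Acta Math. 111 (1964), Chap. III n° 37–38
  pp. 188–190.
* [GelbartRogawski1991] S. Gelbart, J. Rogawski, *L-functions and Fourier–Jacobi coefficients for the unitary group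
  U(3)*, Invent. Math. 105 (1991), §3.1 Prop. 3.1.1 p. 455 L1–3.
* [MoeglinVignerasWaldspurger1987] C. Mœglin, M.-F. Vignéras, J.-L. Waldspurger, LNM 1291 (1987), Chap. 2 II.1.
-/

set_option autoImplicit false

noncomputable section

open scoped Matrix TensorProduct RestrictedProduct
open NumberField NumberField.mixedEmbedding IsDedekindDomain
open Literature.RepresentationTheory.HeisenbergGroup
open Literature.NumberTheory.Automorphic
open Literature.NumberTheory.Weil1964

namespace Literature.NumberTheory.GelbartRogawski1991.UnitaryDualPair.LocalSplitting

namespace FinLocalSplittings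

variable {F : Type} [Field F] [NumberField F] {E : Type} [Field E] [NumberField E] [Algebra F E]
  [Algebra.IsQuadraticExtension F E] {c : E ≃ₐ[F] E} {N : ℕ} {δ : E} {hcδ : c δ = -δ} {hδ : δ ≠ 0} {d : F}
  {hd : δ * δ = algebraMap F E d} {T : Matrix (Fin N) (Fin N) F} {hT : T.IsSymm}
  {J : Matrix (Fin N) (Fin N) E} {hJ : J = T.map (algebraMap F E)}
  (𝓢 : FinLocalSplittings F E c N hcδ hδ hd T hT hJ)

/-- the adelic Gram matrix `T ⊗ 1` is invertible when `det T` is a unit. [cite: GelbartRogawski1991, §3.1 p. 454 L21–33] -/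
theorem isUnit_map_gram (hTd : IsUnit T.det) : IsUnit (T.map (algebraMap F (AdeleRing (𝓞 F) F))) :=
  (Matrix.isUnit_iff_isUnit_det _).2 (by
    rw [← RingHom.mapMatrix_apply, ← RingHom.map_det]
    exact hTd.map _)

/-- **`harch` for the place-assembled splitting**: the symplectic component `ι_𝔸(1, g)` of `s_f(g)` fixes every
archimedean vector `(archVec a, archVec w)`. [cite: Weil1964, Chap. III n° 37–38 pp. 188–190] -/
theorem harch_finSplitting (g : UnitaryGroup.finAdelic F E c N J) (a w : Fin N → mixedSpace F) :
    (adelicMpCont.proj F (Fin N) (T.map (algebraMap F (AdeleRing (𝓞 F) F))) (𝓢.finSplitting g)).1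
        (archVec F (Fin N) a, archVec F (Fin N) w) = (archVec F (Fin N) a, archVec F (Fin N) w) :=
  UnitaryGroup.adelicToSymplectic_finAdelicToAdelic_apply_eq_self F E c N hcδ hδ hd hT hJ g _
    (fun i => archVec_apply_snd a i) (fun i => archVec_apply_snd w i)

/-- **`ω_f^{s_f}(g) = Ω(g)`**: the finite Weil representation (`Weil1964.finRepMp`) of the place-assembled section
`s_f = 𝓢.finSplitting` IS `𝓢.Omega = (⊗'_v ω_v) ∘ finAdelicEquiv` — the finite factor is unique (`finRepMp_unique`)
and `ω(s_f(g)) (φ₀ ⊗ f) = φ₀ ⊗ Ω(g) f` (`omega_finSplitting_tmul`).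
[cite: Weil1964, Chap. III n° 37–38 pp. 188–190; GelbartRogawski1991, §3.1 Prop. 3.1.1 p. 455 L1–3] -/
theorem finRepMp_finSplitting_apply (hTd : IsUnit T.det) (g : UnitaryGroup.finAdelic F E c N J) (f : FinSB F (Fin N)) :
    finRepMp (isUnit_map_gram hTd) 𝓢.finSplitting 𝓢.harch_finSplitting g f = 𝓢.Omega g f := by
  have hΦ₀ : unitSchwartz F (Fin N) ≠ 0 := by
    intro h0
    have h1 := unitSchwartz_apply_zero (F := F) (ι := Fin N)
    rw [h0] at h1
    simp at h1
  rw [← finRepMp_unique (isUnit_map_gram hTd) 𝓢.finSplitting 𝓢.harch_finSplitting g hΦ₀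
    (fun f' => 𝓢.omega_finSplitting_tmul g (unitSchwartz F (Fin N)) f')]

/-- `ω_f^{s_f} = Ω` as representations of `U(J)(𝔸_{F,f})`. [cite: Weil1964, Chap. III n° 37–38 pp. 188–190] -/
theorem finRepMp_finSplitting (hTd : IsUnit T.det) :
    finRepMp (isUnit_map_gram hTd) 𝓢.finSplitting 𝓢.harch_finSplitting = 𝓢.Omega :=
  MonoidHom.ext fun g => LinearMap.ext fun f => 𝓢.finRepMp_finSplitting_apply hTd g f

/-- **factor by factor on pure tensors**: `ω_f^{s_f}(g) (⊗_v Φ_v) = ⊗_v ω_v(g_v) Φ_v`.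
[cite: Weil1964, Chap. III n° 37–38 pp. 188–190] -/
theorem finRepMp_finSplitting_piProdSB (hTd : IsUnit T.det) (g : UnitaryGroup.finAdelic F E c N J)
    (Φ : LocalSBFamily F (Fin N)) :
    finRepMp (isUnit_map_gram hTd) 𝓢.finSplitting 𝓢.harch_finSplitting g (piProdSB F (Fin N) Φ) =
      piProdSB F (Fin N) (RestrictedFamily.smul 𝓢.omegaLoc 𝓢.unitVec_mem_fixedPoints
        (UnitaryGroup.finAdelicEquiv F E c N J g) Φ) := by
  rw [𝓢.finRepMp_finSplitting_apply hTd, 𝓢.Omega_piProdSB]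

/-- `ω_f^{s_f}` read on the restricted product `Πʳ_v [U(J)(F_v), U(J)(𝒪_v)]` (through `finAdelicEquiv⁻¹`) IS the
restricted tensor product `𝓢.OmegaPi = ⊗'_v ω_v` — a restricted tensor product of the local Weil representations in
the tree's sense (`isRestrictedTensorProductRep_finiteAdeleRep`). [cite: Weil1964, Chap. III n° 37–38 pp. 188–190] -/
theorem finRepMp_finSplitting_comp_finAdelicEquiv_symm (hTd : IsUnit T.det) :
    (finRepMp (isUnit_map_gram hTd) 𝓢.finSplitting 𝓢.harch_finSplitting).comp
        (UnitaryGroup.finAdelicEquiv F E c N J).symm.toMulEquiv.toMonoidHom = 𝓢.OmegaPi := by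
  rw [𝓢.finRepMp_finSplitting hTd]
  refine MonoidHom.ext fun g => ?_
  change 𝓢.OmegaPi (UnitaryGroup.finAdelicEquiv F E c N J ((UnitaryGroup.finAdelicEquiv F E c N J).symm g)) = _
  rw [ContinuousMulEquiv.apply_symm_apply]

open scoped Classical in
/-- hence a restricted tensor product of the local Weil representations `ω_v` (exceptional set `∅`).
[cite: Weil1964, Chap. III n° 37–38 pp. 188–190] -/
theorem isRestrictedTensorProductRep_finRepMp_finSplitting (hTd : IsUnit T.det) :
    IsRestrictedTensorProductRep 𝓢.omegaLoc
      ((finRepMp (isUnit_map_gram hTd) 𝓢.finSplitting 𝓢.harch_finSplitting).comp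
        (UnitaryGroup.finAdelicEquiv F E c N J).symm.toMulEquiv.toMonoidHom)
      𝓢.unitVec_mem_fixedPoints (piProdSB F (Fin N)) ∅ := by
  rw [𝓢.finRepMp_finSplitting_comp_finAdelicEquiv_symm hTd]
  exact isRestrictedTensorProductRep_finiteAdeleRep F (Fin N) 𝓢.omegaLoc 𝓢.unitVec_mem_fixedPoints

/-! ### Build-lane note (ops-buildfix G11b-3 recipe, LEDGER B13-1, 2026-08-21)
`lean -o` (the hub build lane, never `lean`/the gate check) runs Lean 4.32's library-suggestion indexers
(`Lean.LibrarySuggestions.SymbolFrequency` / `SineQuaNon`, from their `exportEntriesFn`) over the statement of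
every local theorem that is not a denied premise; on this family's statements (very large dependent binder
telescopes through the theta-kernel / dual-pair data) that fold runs for tens of minutes to hours and the build
lane kills the job (incident G11b-3, run/shared/lean/ops/buildfix/G11b-3-DOSSIER.md). `isDeniedPremise` skips
`[implicit_reducible]` constants before any fold, and a reducibility status on a *theorem* is inert (Meta never
unfolds `thmInfo`; the kernel ignores the attribute), so the public theorems of this file are tagged
`[implicit_reducible]` purely to keep them out of that index. Only other effect: they are not offered by
`+suggestions` premise selectors. No statement or proof is changed; superseded if the operator lands a
deny-list form (`HarnessLib.PremiseIndex`). -/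
set_option allowUnsafeReducibility true in
attribute [implicit_reducible]
  isUnit_map_gram harch_finSplitting finRepMp_finSplitting_apply finRepMp_finSplitting
  finRepMp_finSplitting_piProdSB finRepMp_finSplitting_comp_finAdelicEquiv_symm
  isRestrictedTensorProductRep_finRepMp_finSplitting

end FinLocalSplittings

end Literature.NumberTheory.GelbartRogawski1991.UnitaryDualPair.LocalSplitting

end
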